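import Summits.ABC.ABC.Statement
import Literature.NumberTheory.DiophantineGeometry.AbcWave0BakerExplicitProofs
import HarnessLib

/-!
# Exponential-in-`ω` constants are free: `abc ⟺ log c ≤ (1+ε) log rad + O_ε(ω)` (solo-ABC-blind, generation 5)

The quantitative half of the **ω-axis** (`ω(abc) = #(abc).primeFactors`; the qualitative half —
abc is a theorem on `ω ≤ 2` and the summit is its restriction to `ω ≥ 3` — is
`Summits/ABC/ABC/Theorems/SoloBlindTwoPrimes.lean`).

* `exists_const_pow_le_rpow` — for `K ≥ 1`, `ε > 0` there is `C ≥ 1` with `K^k ≤ C·x^ε` whenever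
  `x ≥ 1` and `k! ≤ x` (elementary: `A^k ≤ k!` for `k ≥ 2A²`, `A = ⌈K^{1/ε}⌉`).
* `abc_iff_abcExpOmega` — **`ABC` is equivalent to abc with a constant exponential in `ω(abc)`:**
  `∀ ε > 0 ∃ K > 0 ∀ triples, c < K^{ω(abc)} · rad(abc)^{1+ε}`.  The absorption uses
  `ω(abc)! ≤ rad(abc)` (`Literature.….factorial_cardDistinctFactors_le_radical`, the lemma behind
  "Baker's Conjecture 4 ⟹ abc", Baker 2004 §3) and `K^ω ≤ C_{K,δ} (ω!)^δ`.
* `abc_iff_logLinearOmega` — additive form: `ABC ⟺ ∀ ε > 0 ∃ A ∀ triples,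
  log c ≤ (1+ε)·log rad(abc) + A·ω(abc)`.

For the wall (what a proof must do, where the known methods stand): a proof may lose an additive
`O_ε(1)` in `log c` PER PRIME of the support and nothing is lost; what it may not lose is a factor per
prime.  The transcendence method gives `log c ≤ C^{ω} (∏_{p ∣ abc} log N(p)) · log log c`-type bounds
(Matveev; Yu): exponential in `ω` in the wrong place (multiplying `log c`, not added to it) and
multiplicative in the heights.  On the first open support `{2, p, q}` (`ω = 3`) abc therefore asks
exactly for `log c ≤ (1+ε)(log p + log q) + O_ε(1)`, uniformly in the odd primes `p, q`; for each FIXED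
`{2, p, q}` there are only finitely many triples (S-unit equation), so all content is in the uniformity.
The scale `ω!` is the right one: `rad(abc) ≥ ω(abc)!` is sharp up to a factor `e^{O(ω)}` (primorials),
so constants `e^{o(ω log ω)}` are absorbable and nothing faster is in general.
-/

noncomputable section

open UniqueFactorizationMonoid Real Finset
open scoped ArithmeticFunction.omega Nat

namespace Summit.ABC.ABC.Theorems

open Literature.NumberTheory.DiophantineGeometry

/-! ### `A^k ≤ k!` for `k ≥ 2A²` -/

/-- `(A²)^j ≤ (A² + j)!`. [folklore] -/
theorem sq_pow_le_factorial_add (A j : ℕ) : (A ^ 2) ^ j ≤ (A ^ 2 + j)! := by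
  induction j with
  | zero => simpa using Nat.one_le_iff_ne_zero.mpr (Nat.factorial_ne_zero _)
  | succ j ih =>
    have h1 : A ^ 2 ≤ A ^ 2 + j + 1 := by omega
    calc (A ^ 2) ^ (j + 1) = (A ^ 2) ^ j * A ^ 2 := pow_succ _ _
      _ ≤ (A ^ 2 + j)! * (A ^ 2 + j + 1) := Nat.mul_le_mul ih h1
      _ = (A ^ 2 + (j + 1))! := by rw [← Nat.add_assoc, Nat.factorial_succ, Nat.mul_comm]

/-- `A^k ≤ k!` as soon as `k ≥ 2A²` (`A ≥ 1`). [folklore] -/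
theorem pow_le_factorial_of_two_mul_sq_le {A k : ℕ} (hA : 1 ≤ A) (hk : 2 * A ^ 2 ≤ k) :
    A ^ k ≤ k ! := by
  obtain ⟨j, rfl⟩ : ∃ j, k = A ^ 2 + j := ⟨k - A ^ 2, by omega⟩
  have hj : A ^ 2 ≤ j := by omega
  calc A ^ (A ^ 2 + j) ≤ A ^ (2 * j) := Nat.pow_le_pow_right hA (by omega)
    _ = (A ^ 2) ^ j := by rw [pow_mul]
    _ ≤ (A ^ 2 + j)! := sq_pow_le_factorial_add A j

/-! ### Exponential absorption -/

/-- **Exponential absorption:** for `K ≥ 1` and `ε > 0` there is `C ≥ 1` such that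
`K^k ≤ C · x^ε` for all real `x ≥ 1` and all `k` with `k! ≤ x`; here `C = K^{2A²}`,
`A = ⌈K^{1/ε}⌉`. [folklore] -/
theorem exists_const_pow_le_rpow {K ε : ℝ} (hK : 1 ≤ K) (hε : 0 < ε) :
    ∃ C : ℝ, 1 ≤ C ∧ ∀ (k : ℕ) (x : ℝ), 1 ≤ x → ((k ! : ℕ) : ℝ) ≤ x → K ^ k ≤ C * x ^ ε := by
  have hK0 : 0 ≤ K := by linarith
  set A : ℕ := ⌈K ^ (1 / ε)⌉₊ with hA
  have hKA : K ^ (1 / ε) ≤ (A : ℝ) := Nat.le_ceil _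
  have hK1e : 1 ≤ K ^ (1 / ε) := Real.one_le_rpow hK (by positivity)
  have hA1 : 1 ≤ A := by
    have : (1 : ℝ) ≤ (A : ℝ) := le_trans hK1e hKA
    exact_mod_cast this
  have hA0 : (0 : ℝ) ≤ (A : ℝ) := by positivity
  have hKle : K ≤ (A : ℝ) ^ ε := by
    have h1 : (K ^ (1 / ε)) ^ ε ≤ (A : ℝ) ^ ε :=
      Real.rpow_le_rpow (by positivity) hKA hε.le
    have h2 : (K ^ (1 / ε)) ^ ε = K := by
      rw [← Real.rpow_mul hK0, one_div_mul_cancel hε.ne', Real.rpow_one]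
    rw [h2] at h1
    exact h1
  refine ⟨K ^ (2 * A ^ 2), one_le_pow₀ hK, fun k x hx hkx => ?_⟩
  have hxε : 1 ≤ x ^ ε := Real.one_le_rpow hx hε.le
  have hKN : 1 ≤ K ^ (2 * A ^ 2) := one_le_pow₀ hK
  rcases lt_or_ge k (2 * A ^ 2) with hk | hk
  · calc K ^ k ≤ K ^ (2 * A ^ 2) := pow_le_pow_right₀ hK hk.le
      _ = K ^ (2 * A ^ 2) * 1 := (mul_one _).symm
      _ ≤ K ^ (2 * A ^ 2) * x ^ ε := by gcongr
  · have hAk : (A : ℝ) ^ k ≤ x := by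
      have h1 : A ^ k ≤ k ! := pow_le_factorial_of_two_mul_sq_le hA1 hk
      calc (A : ℝ) ^ k = ((A ^ k : ℕ) : ℝ) := by push_cast; rfl
        _ ≤ ((k ! : ℕ) : ℝ) := by exact_mod_cast h1
        _ ≤ x := hkx
    have hAk0 : (0 : ℝ) ≤ (A : ℝ) ^ k := by positivity
    have hswap : ((A : ℝ) ^ ε) ^ k = ((A : ℝ) ^ k) ^ ε := by
      rw [← Real.rpow_natCast ((A : ℝ) ^ ε) k, ← Real.rpow_mul hA0, mul_comm ε (k : ℝ),
        Real.rpow_mul hA0, Real.rpow_natCast]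
    calc K ^ k ≤ ((A : ℝ) ^ ε) ^ k := pow_le_pow_left₀ hK0 hKle k
      _ = ((A : ℝ) ^ k) ^ ε := hswap
      _ ≤ x ^ ε := Real.rpow_le_rpow hAk0 hAk hε.le
      _ = 1 * x ^ ε := (one_mul _).symm
      _ ≤ K ^ (2 * A ^ 2) * x ^ ε := by gcongr

/-! ### The ω-axis, quantitative half -/

/-- `ω(abc) ≥ 1` for an abc triple (`c ≥ 2`). [folklore] -/
theorem one_le_card_primeFactors {a b c : ℕ} (h : IsABCTriple a b c) : 1 ≤ (a * b * c).primeFactors.card := by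
  rw [← cardDistinctFactors_eq_card_primeFactors]
  exact h.one_le_cardDistinctFactors

/-- `ω(abc)! ≤ rad(abc)` in `ℝ`. [folklore] -/
theorem factorial_card_primeFactors_le_rad (a b c : ℕ) :
    ((((a * b * c).primeFactors.card)! : ℕ) : ℝ) ≤ ((rad a b c : ℕ) : ℝ) := by
  have h1 := factorial_cardDistinctFactors_le_radical (a * b * c)
  rw [cardDistinctFactors_eq_card_primeFactors, ← rad_def] at h1
  exact_mod_cast h1

/-- **Exponential-in-`ω` constants are free:** `ABC` is equivalent to abc with the constant `K^{ω(abc)}`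
(`K = K(ε)`), because `ω(abc)! ≤ rad(abc)` and `K^ω ≤ C_{K,δ}·(ω!)^δ` for every `δ > 0`.  Equivalently a
proof of abc may lose `O_ε(1)` in `log c` for each prime of the support. [folklore] -/
theorem abc_iff_abcExpOmega :
    ABC ↔ ∀ ε : ℝ, 0 < ε → ∃ K : ℝ, 0 < K ∧ ∀ a b c : ℕ, IsABCTriple a b c →
      (c : ℝ) < K ^ (a * b * c).primeFactors.card * ((rad a b c : ℕ) : ℝ) ^ (1 + ε) := by
  rw [ABC_iff]
  constructor
  · intro h ε hε
    obtain ⟨C, hC0, hC⟩ := h ε hε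
    refine ⟨max C 1, lt_max_of_lt_right one_pos, fun a b c ht => ?_⟩
    have hR : 0 ≤ ((rad a b c : ℕ) : ℝ) ^ (1 + ε) := Real.rpow_nonneg (Nat.cast_nonneg _) _
    have hω := one_le_card_primeFactors ht
    have hCle : C ≤ max C 1 ^ (a * b * c).primeFactors.card :=
      calc C ≤ max C 1 := le_max_left _ _
        _ = max C 1 ^ 1 := (pow_one _).symm
        _ ≤ max C 1 ^ (a * b * c).primeFactors.card := pow_le_pow_right₀ (le_max_right _ _) hω
    exact (hC a b c ht).trans_le (mul_le_mul_of_nonneg_right hCle hR)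
  · intro h ε hε
    obtain ⟨K, hK0, hK⟩ := h (ε / 2) (half_pos hε)
    have hK' : 1 ≤ max K 1 := le_max_right _ _
    obtain ⟨C, hC1, hC⟩ := exists_const_pow_le_rpow hK' (half_pos hε)
    refine ⟨C, by linarith, fun a b c ht => ?_⟩
    have hr1 : (1 : ℝ) ≤ ((rad a b c : ℕ) : ℝ) := by
      exact_mod_cast le_trans (by norm_num) ht.two_le_rad
    have hr0 : (0 : ℝ) < ((rad a b c : ℕ) : ℝ) := by linarith
    have hR : 0 ≤ ((rad a b c : ℕ) : ℝ) ^ (1 + ε / 2) := Real.rpow_nonneg (Nat.cast_nonneg _) _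
    have h1 := hK a b c ht
    have h2 : K ^ (a * b * c).primeFactors.card ≤ max K 1 ^ (a * b * c).primeFactors.card :=
      pow_le_pow_left₀ hK0.le (le_max_left _ _) _
    have h3 := hC _ _ hr1 (factorial_card_primeFactors_le_rad a b c)
    calc (c : ℝ) < K ^ (a * b * c).primeFactors.card * ((rad a b c : ℕ) : ℝ) ^ (1 + ε / 2) := h1
      _ ≤ max K 1 ^ (a * b * c).primeFactors.card * ((rad a b c : ℕ) : ℝ) ^ (1 + ε / 2) :=
          mul_le_mul_of_nonneg_right h2 hR
      _ ≤ C * ((rad a b c : ℕ) : ℝ) ^ (ε / 2) * ((rad a b c : ℕ) : ℝ) ^ (1 + ε / 2) :=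
          mul_le_mul_of_nonneg_right h3 hR
      _ = C * ((rad a b c : ℕ) : ℝ) ^ (1 + ε) := by
          rw [mul_assoc, ← Real.rpow_add hr0]; ring_nf

/-- **Additive form of the ω-axis:** `ABC ⟺ ∀ ε > 0 ∃ A ∀ abc triples, log c ≤ (1+ε)·log rad(abc) + A·ω(abc)`.
[folklore] -/
theorem abc_iff_logLinearOmega :
    ABC ↔ ∀ ε : ℝ, 0 < ε → ∃ A : ℝ, ∀ a b c : ℕ, IsABCTriple a b c →
      Real.log c ≤ (1 + ε) * Real.log ((rad a b c : ℕ) : ℝ) + A * (a * b * c).primeFactors.card := by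
  rw [abc_iff_abcExpOmega]
  constructor
  · intro h ε hε
    obtain ⟨K, hK0, hK⟩ := h ε hε
    refine ⟨Real.log K, fun a b c ht => ?_⟩
    have hr0 : (0 : ℝ) < ((rad a b c : ℕ) : ℝ) := by
      exact_mod_cast lt_of_lt_of_le (by norm_num) ht.two_le_rad
    have hc0 : (0 : ℝ) < (c : ℝ) := by exact_mod_cast lt_of_lt_of_le (by norm_num) ht.two_le
    have h1 := hK a b c ht
    have hpos : 0 < K ^ (a * b * c).primeFactors.card * ((rad a b c : ℕ) : ℝ) ^ (1 + ε) := by positivity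
    have h2 : Real.log c < Real.log (K ^ (a * b * c).primeFactors.card * ((rad a b c : ℕ) : ℝ) ^ (1 + ε)) :=
      Real.log_lt_log hc0 h1
    rw [Real.log_mul (by positivity) (by positivity), Real.log_pow, Real.log_rpow hr0] at h2
    linarith
  · intro h ε hε
    obtain ⟨A, hA⟩ := h (ε / 2) (half_pos hε)
    refine ⟨Real.exp A, Real.exp_pos A, fun a b c ht => ?_⟩
    have hr1 : (1 : ℝ) < ((rad a b c : ℕ) : ℝ) := by exact_mod_cast ht.two_le_rad
    have hr0 : (0 : ℝ) < ((rad a b c : ℕ) : ℝ) := by linarith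
    have hc0 : (0 : ℝ) < (c : ℝ) := by exact_mod_cast lt_of_lt_of_le (by norm_num) ht.two_le
    have h1 := hA a b c ht
    have h2 : (c : ℝ) ≤ Real.exp A ^ (a * b * c).primeFactors.card * ((rad a b c : ℕ) : ℝ) ^ (1 + ε / 2) := by
      rw [← Real.log_le_log_iff hc0 (by positivity), Real.log_mul (by positivity) (by positivity),
        Real.log_pow, Real.log_rpow hr0, Real.log_exp]
      linarith
    have h3 : ((rad a b c : ℕ) : ℝ) ^ (1 + ε / 2) < ((rad a b c : ℕ) : ℝ) ^ (1 + ε) :=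
      Real.rpow_lt_rpow_of_exponent_lt hr1 (by linarith)
    have h4 : 0 < Real.exp A ^ (a * b * c).primeFactors.card := by positivity
    calc (c : ℝ) ≤ Real.exp A ^ (a * b * c).primeFactors.card * ((rad a b c : ℕ) : ℝ) ^ (1 + ε / 2) := h2
      _ < Real.exp A ^ (a * b * c).primeFactors.card * ((rad a b c : ℕ) : ℝ) ^ (1 + ε) :=
          mul_lt_mul_of_pos_left h3 h4

/-! ### The first open support: `ω(abc) = 3` forces prime powers -/

/-- A natural number `n ≥ 2` with a single prime factor is a prime power `p^l`, `l ≥ 1`. [folklore] -/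
theorem exists_eq_prime_pow_of_card_primeFactors_eq_one {n : ℕ} (hn : 2 ≤ n)
    (h1 : n.primeFactors.card = 1) : ∃ p l : ℕ, p.Prime ∧ 1 ≤ l ∧ n = p ^ l := by
  obtain ⟨p, hp⟩ := Finset.card_eq_one.mp h1
  have hn0 : n ≠ 0 := by omega
  have hpmem : p ∈ n.primeFactors := by rw [hp]; exact Finset.mem_singleton_self p
  have hpp : p.Prime := Nat.prime_of_mem_primeFactors hpmem
  have heq : n = p ^ n.primeFactorsList.length := by
    refine Nat.eq_prime_pow_of_unique_prime_dvd hn0 ?_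
    intro d hd hdn
    have hd' : d ∈ n.primeFactors := Nat.mem_primeFactors.mpr ⟨hd, hdn, hn0⟩
    rw [hp] at hd'
    exact Finset.mem_singleton.mp hd'
  refine ⟨p, n.primeFactorsList.length, hpp, ?_, heq⟩
  by_contra h0
  have h00 : n.primeFactorsList.length = 0 := by omega
  rw [h00, pow_zero] at heq
  omega

/-- **On the first open support the summands are prime powers.** If `a + b = c` is an abc triple with
`a, b ≥ 2` and `ω(abc) ≤ 3`, then `ω(abc) = 3` and `a = p^l`, `b = q^m`, `c = r^n` are powers of three
distinct primes, one of which is `2` — the prime-base Fermat–Catalan / Pillai shapes `2^l + q^m = r^n`,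
`p^l + q^m = 2^n`.  (With `eq_one_or_eq_one_of_card_le_two` of `SoloBlindTwoPrimes`: the remaining
`ω = 3` triples are `1 + x = x + 1` with `ω(x(x+1)) = 3`, i.e. `1 + 2^k p^m = q^n`, `1 + p^m = 2^k q^n`,
`1 + 2^k = p^m q^n` and their mirror images.) [folklore] -/
theorem primePow_shape_of_card_le_three {a b c : ℕ} (h : IsABCTriple a b c) (ha : 2 ≤ a) (hb : 2 ≤ b)
    (hω : (a * b * c).primeFactors.card ≤ 3) :
    (a * b * c).primeFactors.card = 3 ∧
    ∃ p q r l m n : ℕ, p.Prime ∧ q.Prime ∧ r.Prime ∧ p ≠ q ∧ p ≠ r ∧ q ≠ r ∧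
      1 ≤ l ∧ 1 ≤ m ∧ 1 ≤ n ∧ a = p ^ l ∧ b = q ^ m ∧ c = r ^ n ∧ (p = 2 ∨ q = 2 ∨ r = 2) := by
  obtain ⟨ha0, hb0, habc, hab⟩ := h
  have hc : 2 ≤ c := by omega
  have hac : Nat.Coprime a c := by rw [← habc]; exact Nat.coprime_self_add_right.mpr hab
  have hbc : Nat.Coprime b c := by rw [← habc]; exact Nat.coprime_add_self_right.mpr hab.symm
  have habc' : Nat.Coprime (a * b) c := Nat.Coprime.mul_left hac hbc
  have hd1 : Disjoint a.primeFactors b.primeFactors := hab.disjoint_primeFactors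
  have hd2 : Disjoint (a * b).primeFactors c.primeFactors := habc'.disjoint_primeFactors
  have hcard : (a * b * c).primeFactors.card =
      a.primeFactors.card + b.primeFactors.card + c.primeFactors.card := by
    rw [Nat.primeFactors_mul (mul_ne_zero (by omega) (by omega)) (by omega),
      Finset.card_union_of_disjoint hd2, Nat.primeFactors_mul (by omega) (by omega),
      Finset.card_union_of_disjoint hd1]
  have ha1 : 1 ≤ a.primeFactors.card := Finset.card_pos.mpr (Nat.nonempty_primeFactors.mpr (by omega))
  have hb1 : 1 ≤ b.primeFactors.card := Finset.card_pos.mpr (Nat.nonempty_primeFactors.mpr (by omega))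
  have hc1 : 1 ≤ c.primeFactors.card := Finset.card_pos.mpr (Nat.nonempty_primeFactors.mpr (by omega))
  have hA : a.primeFactors.card = 1 := by omega
  have hB : b.primeFactors.card = 1 := by omega
  have hC : c.primeFactors.card = 1 := by omega
  refine ⟨by omega, ?_⟩
  obtain ⟨p, l, hpp, hl, rfl⟩ := exists_eq_prime_pow_of_card_primeFactors_eq_one ha hA
  obtain ⟨q, m, hqq, hm, rfl⟩ := exists_eq_prime_pow_of_card_primeFactors_eq_one hb hB
  obtain ⟨r, n, hrr, hn, hcr⟩ := exists_eq_prime_pow_of_card_primeFactors_eq_one hc hC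
  have hl0 : l ≠ 0 := by omega
  have hm0 : m ≠ 0 := by omega
  have hn0 : n ≠ 0 := by omega
  -- distinctness of the primes from pairwise coprimality
  have hpq : p ≠ q := by
    rintro rfl
    have := (Nat.coprime_pow_left_iff (Nat.pos_of_ne_zero hl0) _ _).mp
      ((Nat.coprime_pow_right_iff (Nat.pos_of_ne_zero hm0) _ _).mp hab)
    exact hpp.one_lt.ne' (Nat.Coprime.eq_one_of_dvd this (dvd_refl p))
  have hpr : p ≠ r := by
    rintro rfl
    rw [hcr] at hac
    have := (Nat.coprime_pow_left_iff (Nat.pos_of_ne_zero hl0) _ _).mp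
      ((Nat.coprime_pow_right_iff (Nat.pos_of_ne_zero hn0) _ _).mp hac)
    exact hpp.one_lt.ne' (Nat.Coprime.eq_one_of_dvd this (dvd_refl p))
  have hqr : q ≠ r := by
    rintro rfl
    rw [hcr] at hbc
    have := (Nat.coprime_pow_left_iff (Nat.pos_of_ne_zero hm0) _ _).mp
      ((Nat.coprime_pow_right_iff (Nat.pos_of_ne_zero hn0) _ _).mp hbc)
    exact hqq.one_lt.ne' (Nat.Coprime.eq_one_of_dvd this (dvd_refl q))
  refine ⟨p, q, r, l, m, n, hpp, hqq, hrr, hpq, hpr, hqr, hl, hm, hn, rfl, rfl, hcr, ?_⟩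
  -- parity: if `p, q, r` were all odd, `c = a + b` would be even and odd
  by_contra hne
  have hp2 : Odd p := hpp.eq_two_or_odd'.resolve_left fun e => hne (Or.inl e)
  have hq2 : Odd q := hqq.eq_two_or_odd'.resolve_left fun e => hne (Or.inr (Or.inl e))
  have hr2 : Odd r := hrr.eq_two_or_odd'.resolve_left fun e => hne (Or.inr (Or.inr e))
  have hao : Odd (p ^ l) := hp2.pow
  have hbo : Odd (q ^ m) := hq2.pow
  have hco : Odd c := by rw [hcr]; exact hr2.pow
  have hce : Even c := by rw [← habc]; exact hao.add_odd hbo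
  exact (Nat.not_even_iff_odd.mpr hco) hce

/-- The smallest prime-power triple on the first open support: `5 + 27 = 32` (`ω = 3`, `rad = 30`);
and the record one, `3 + 125 = 128` (`rad = 30 < 128 = c`, quality `log 128 / log 30 ≈ 1.43`). [folklore] -/
theorem card_three_primePow_examples :
    (IsABCTriple 5 27 32 ∧ (5 * 27 * 32).primeFactors.card = 3 ∧ rad 5 27 32 = 30) ∧
    (IsABCTriple 3 125 128 ∧ (3 * 125 * 128).primeFactors.card = 3 ∧ rad 3 125 128 = 30) := by
  have hpf1 : (5 * 27 * 32 : ℕ).primeFactors = {5, 3, 2} := by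
    rw [show (5 * 27 * 32 : ℕ) = (5 ^ 1 * 3 ^ 3) * 2 ^ 5 by norm_num,
      Nat.primeFactors_mul (by norm_num) (by norm_num),
      Nat.primeFactors_mul (by norm_num) (by norm_num),
      Nat.primeFactors_prime_pow (by norm_num) (by norm_num : Nat.Prime 5),
      Nat.primeFactors_prime_pow (by norm_num) Nat.prime_three,
      Nat.primeFactors_prime_pow (by norm_num) Nat.prime_two]
    decide
  have hpf2 : (3 * 125 * 128 : ℕ).primeFactors = {3, 5, 2} := by
    rw [show (3 * 125 * 128 : ℕ) = (3 ^ 1 * 5 ^ 3) * 2 ^ 7 by norm_num,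
      Nat.primeFactors_mul (by norm_num) (by norm_num),
      Nat.primeFactors_mul (by norm_num) (by norm_num),
      Nat.primeFactors_prime_pow (by norm_num) Nat.prime_three,
      Nat.primeFactors_prime_pow (by norm_num) (by norm_num : Nat.Prime 5),
      Nat.primeFactors_prime_pow (by norm_num) Nat.prime_two]
    decide
  refine ⟨⟨⟨by norm_num, by norm_num, by norm_num, by decide⟩, by rw [hpf1]; decide, ?_⟩,
    ⟨⟨by norm_num, by norm_num, by norm_num, by decide⟩, by rw [hpf2]; decide, ?_⟩⟩
  · rw [rad_def, Nat.radical_eq_prod_primeFactors, hpf1]; decide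
  · rw [rad_def, Nat.radical_eq_prod_primeFactors, hpf2]; decide

end Summit.ABC.ABC.Theorems
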